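import Summits.KontsevichZagierPeriods.KontsevichZagierPeriods.Theses.IsogenyCertificates
import Summits.KontsevichZagierPeriods.KontsevichZagierPeriods.Theorems.XMapKernel.Negative.Core
import Summits.KontsevichZagierPeriods.KontsevichZagierPeriods.Theorems.IsogenyCertificatesXMapKernelStubSectorRepsExist
import Summits.KontsevichZagierPeriods.KontsevichZagierPeriods.Theorems.IsogenyCertificatesXMapKernelStubOrbitCollapse
import Summits.KontsevichZagierPeriods.KontsevichZagierPeriods.Theorems.IsogenyCertificatesXMapKernelStubDatumOfRatMult
import Summits.KontsevichZagierPeriods.KontsevichZagierPeriods.Theorems.IsogenyCertificatesXMapKernelStubHuberWustholzSplitting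
import Summits.KontsevichZagierPeriods.KontsevichZagierPeriods.Theorems.IsogenyCertificatesXMapKernelStubMultiplierRigidity
import Summits.KontsevichZagierPeriods.KontsevichZagierPeriods.Theorems.IsogenyCertificatesXMapKernelStubClassReduction
import Summits.KontsevichZagierPeriods.KontsevichZagierPeriods.Theorems.IsogenyCertificatesXMapKernelStubNonCMClass
import Summits.KontsevichZagierPeriods.KontsevichZagierPeriods.Theorems.IsogenyCertificatesXMapKernelStubCMClass
import Summits.KontsevichZagierPeriods.KontsevichZagierPeriods.Theorems.IsogenyCertificatesXMapKernelStubRadicalIndependence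
import Summits.KontsevichZagierPeriods.KontsevichZagierPeriods.Theorems.IsogenyCertificatesXMapKernelStubCellCollapse
import Literature.NumberTheory.Transcendental.TwoCurvePeriods
import Literature.NumberTheory.Transcendental.ManyCurvePeriods
import Literature.NumberTheory.Transcendental.ManyCurveThetaClassification

/-!
# Skeleton — crux `XMapKernel` (stmt-KontsevichZagierPeriods-10663), line `isogeny-orbit-collapse`
(payload slug `line-isogeny-orbit-collapse`; lead prover a2's work file = lead 0's reshape 2 with the stub HW CLOSED,
registration 3).

Registration 3 (lead a2, 2026-08-16): the named fact `HuberWustholzManyCurvePeriods` is now a THEOREM of the tree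
(`Literature.NumberTheory.Transcendental.HuberWustholzManyCurvePeriods_holds`, `ManyCurveThetaClassification.lean`,
axioms standard), so `stub_huberWustholzManyCurvePeriods` below is CLOSED by `exact` and the discharge is landed under
`Theorems/IsogenyCertificatesXMapKernelCellsUnconditional.lean` (real-period cell, (ω,η)-egg cell, elliptic-sector cell
and every line's remainder ↔ summit, all unconditional). The skeleton now has EXACTLY ONE `sorry`: K =
`stub_reductionToRealPeriodSector`, and K ↔ `KontsevichZagierPeriods` is an unconditional theorem
(`XMapKernelCells.reductionToRealPeriodSector_iff_summit_holds`; the crux itself ↔ the summit,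
`XMapKernelIffSummit.xMapKernel_iff_summit`, p116992). What follows is lead 0's record of reshape 2.

History. Reshape 1 (registration 1): stubs S V T R-a R-b C K re-authored from the planner's registered
signatures, R split into R-a/R-b. LANDED since: S (`…XMapKernelStubs.SectorRepsExist.stub_sectorRepsExist`,
p86953), V (`…OrbitCollapse.stub_orbitCollapse`, p89347), R-a (`…DatumOfRatMult.stub_datumOfRatMult`, p91756),
and T CONDITIONALLY on the tree's named fact `Literature.NumberTheory.Transcendental.HuberWustholzManyCurvePeriods`
(`…HuberWustholzSplitting.stub_huberWustholzSplitting_of`, p91000). Reshape 2 (this file): the composition is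
made CONDITIONAL on that named fact (honest "closed modulo HuberWustholzManyCurvePeriods"), and R-b is split into
R-b0 (Aut(ℂ)-rigidity of lattice multipliers), R-b1 (class reduction over the fact), R-b2 (non-CM class),
R-b3 (CM class), R-b4 (linear independence of positive real radicals, Mordell 1953), glued here by
`independenceModRatMult`.

Composition (`XMapKernel_of`): K reduces a kernel element `c` to an element `c'` of the real-period sector
modulo `closure gens`; soundness (`closure_gens_le_ker_eval`) gives `eval c' = 0`; the CELL theorem C (from
S = reps exist, V = orbit collapse, RPI = real-period independence) puts `c'` in `closure gens`; RPI is
`independenceModRatMult` (R-b0…R-b4 over the fact) plus "no datum ⇒ no rational lattice multiplier" (R-a).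

Wave 2 LANDED R-b0 (p92278), R-b1 (p93218), R-b2 (p94369 + aux p93902), R-b3 (p94914 + aux p94620), R-b4 (p92767).
Lead LANDED C (`stub_cellCollapse`, p95059). The ONLY remaining sorry is K (`stub_reductionToRealPeriodSector`), the
GPC-strength remainder (Disproof F1 / Sanity.lean `crux_iff_cell_and_k`: given the cell, K ↔ the crux; modulo
`XMapPeriodTransfer`, the crux ↔ `KZKernelConjecture` ↔ the summit). So the line is CLOSED MODULO {K, the named fact
`HuberWustholzManyCurvePeriods` (declared below as `stub_huberWustholzManyCurvePeriods` so that the registration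
shows it)}: the real-period cell of `XMapKernel` is a theorem of the tree conditional on Wüstholz
(`Theorems/IsogenyCertificatesXMapKernelRealPeriodCell.lean`, p95323: `realPeriodCellKernel`, `xMapKernel_iff_reduction`).
-/

noncomputable section

-- work file under `Cruxes/…/Lines`: the prescribed namespace repeats the summit name; silence only that linter.
set_option linter.dupNamespace false

namespace Summit.KontsevichZagierPeriods.KontsevichZagierPeriods.Cruxes.XMapKernel.Lines.IsogenyOrbitCollapse

open scoped BigOperators
open Literature.NumberTheory.Transcendental
open Summit.KontsevichZagierPeriods.KontsevichZagierPeriods.Theses.IsogenyCertificates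
open Set MeasureTheory

/-! ### Closed stubs (landed under `Theorems/`, restated verbatim) -/

/-- **S** (LANDED p86953) — the sector representations `[{P>0}, a/√P]` are honest `IntegralRep 1`'s. -/
theorem stub_sectorRepsExist : ∀ (A B : ℤ) (a : ℚ), 4 * A ^ 3 + 27 * B ^ 2 ≠ 0 → ∃ r : Literature.NumberTheory.Transcendental.KZ.IntegralRep 1, r.domain = {x | 0 < x 0 ^ 3 + (A : ℝ) * x 0 + (B : ℝ)} ∧ r.integrand = fun x => (a : ℝ) / Real.sqrt (x 0 ^ 3 + (A : ℝ) * x 0 + (B : ℝ)) :=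
  Summit.KontsevichZagierPeriods.IsogenyCertificates.XMapKernelStubs.SectorRepsExist.stub_sectorRepsExist

/-- **V** (LANDED p89347) — orbit collapse: along an x-rational isogeny datum the full real periods have a
positive rational ratio. -/
theorem stub_orbitCollapse : ∀ (A B A' B' : ℤ), 4 * A ^ 3 + 27 * B ^ 2 ≠ 0 → 4 * A' ^ 3 + 27 * B' ^ 2 ≠ 0 → (∃ (f g : Polynomial ℚ) (c : ℚ), Polynomial.derivative f * g - f * Polynomial.derivative g ≠ 0 ∧ Polynomial.C (c ^ 2) * g * (f ^ 3 + Polynomial.C (A' : ℚ) * f * g ^ 2 + Polynomial.C (B' : ℚ) * g ^ 3) = (Polynomial.X ^ 3 + Polynomial.C (A : ℚ) * Polynomial.X + Polynomial.C (B : ℚ)) * (Polynomial.derivative f * g - f * Polynomial.derivative g) ^ 2) → ∃ q : ℚ, 0 < q ∧ (∫ x in {x : Fin 1 → ℝ | 0 < x 0 ^ 3 + (A : ℝ) * x 0 + (B : ℝ)}, 1 / Real.sqrt (x 0 ^ 3 + (A : ℝ) * x 0 + (B : ℝ))) = (q : ℝ) * ∫ x in {x : Fin 1 → ℝ | 0 <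 x 0 ^ 3 + (A' : ℝ) * x 0 + (B' : ℝ)}, 1 / Real.sqrt (x 0 ^ 3 + (A' : ℝ) * x 0 + (B' : ℝ)) :=
  Summit.KontsevichZagierPeriods.IsogenyCertificates.XMapKernelStubs.OrbitCollapse.stub_orbitCollapse

/-- **R-a** (LANDED p91756) — a rational lattice multiplier is realised by an x-rational isogeny datum. -/
theorem stub_datumOfRatMult : ∀ (A B A' B' : ℤ), 4 * A ^ 3 + 27 * B ^ 2 ≠ 0 → 4 * A' ^ 3 + 27 * B' ^ 2 ≠ 0 → ∀ (L L' : PeriodPair) (k : ℚ), L.g₂ = -4 * (A : ℂ) → L.g₃ = -4 * (B : ℂ) → L'.g₂ = -4 * (A' : ℂ) → L'.g₃ = -4 * (B' : ℂ) → k ≠ 0 → (∀ l ∈ L.lattice, (k : ℂ) * l ∈ L'.lattice) → ∃ (f g : Polynomial ℚ) (c : ℚ), Polynomial.derivative f * g - f * Polynomial.derivative g ≠ 0 ∧ Polynomial.C (c ^ 2) * g * (f ^ 3 + Polynomial.C (A' : ℚ) * f * g ^ 2 + Polynomial.C (B' : ℚ) * g ^ 3) = (Polynomial.X ^ 3 +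 Polynomial.C (A : ℚ) * Polynomial.X + Polynomial.C (B : ℚ)) * (Polynomial.derivative f * g - f * Polynomial.derivative g) ^ 2 :=
  Summit.KontsevichZagierPeriods.IsogenyCertificates.XMapKernelStubs.DatumOfRatMult.stub_datumOfRatMult

/-- **T** (LANDED CONDITIONALLY p91000) — Huber–Wüstholz splitting along lattice-isogeny classes, from the
tree's named fact `HuberWustholzManyCurvePeriods` (HuberWustholz2022 Thm 15.3). -/
theorem stub_huberWustholzSplitting (hHW : Literature.NumberTheory.Transcendental.HuberWustholzManyCurvePeriods) : ∀ (k : ℕ) (L : Fin k → PeriodPair) (β β' : Fin k → ℂ), (∀ i, IsAlgebraic ℚ (L i).g₂ ∧ IsAlgebraic ℚ (L i).g₃) → (∀ i, IsAlgebraic ℚ (β i) ∧ IsAlgebraic ℚ (β' i)) → ∑ i, (β i * (L i).ω₁ + β' i * (L i).ω₂) = 0 → ∀ (i : Fin k) (S : Finset (Fin k)), (∀ j, j ∈ S ↔ (L i).IsIsogenousTo (L j)) → ∑ j ∈ S, (β j * (L j).ω₁ + β' j * (L j).ω₂) = 0 :=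
  Summit.KontsevichZagierPeriods.IsogenyCertificates.XMapKernelStubs.HuberWustholzSplitting.stub_huberWustholzSplitting_of hHW

/-- **R-b0** (LANDED p92278) — Aut(ℂ)-rigidity of lattice multipliers: between lattices with RATIONAL invariants, every
field automorphism of `ℂ` carries a multiplier to a multiplier (transport of the transformation identity +
`lattice_le_of_transformation_polynomial_identity`). -/
theorem stub_multiplierRigidity : ∀ (L L' : PeriodPair) (γ : ℂ) (σ : ℂ ≃+* ℂ), (∃ q : ℚ, (q : ℂ) = L.g₂) → (∃ q : ℚ, (q : ℂ) = L.g₃) → (∃ q : ℚ, (q : ℂ) = L'.g₂) → (∃ q : ℚ, (q : ℂ) = L'.g₃) → γ ≠ 0 → (∀ l ∈ L.lattice, γ * l ∈ L'.lattice) → ∀ l ∈ L.lattice, σ γ * l ∈ L'.lattice :=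
  Summit.KontsevichZagierPeriods.IsogenyCertificates.XMapKernelStubs.MultiplierRigidity.stub_multiplierRigidity

/-- **R-b1** (LANDED p93218) — class reduction over the Huber–Wüstholz fact: a vanishing `ℚ`-combination of full real
periods of nonsingular integral cubics vanishes class by class (lattice-isogeny classes of the period
lattices `g₂ = -4A`, `g₃ = -4B`). -/
theorem stub_classReduction : Literature.NumberTheory.Transcendental.HuberWustholzManyCurvePeriods → ∀ (k : ℕ) (A B : Fin k → ℤ) (q : Fin k → ℚ), (∀ i, 4 * A i ^ 3 + 27 * B i ^ 2 ≠ 0) → ∑ i, (q i : ℝ) * (∫ x in {x : Fin 1 → ℝ | 0 < x 0 ^ 3 + (A i : ℝ) * x 0 + (B i : ℝ)}, 1 / Real.sqrt (x 0 ^ 3 + (A i : ℝ) * x 0 + (B i : ℝ))) = 0 → ∀ i, ∃ L₀ : PeriodPair, L₀.g₂ = -4 * (A i : ℂ) ∧ L₀.g₃ = -4 * (B i : ℂ) ∧ ∀ S : Finset (Fin k), (∀ j, j ∈ S ↔ ∃ (L' : PeriodPair) (α : ℂ), L'.g₂ = -4 * (A j : ℂ) ∧ L'.g₃ = -4 * (B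 j : ℂ) ∧ α ≠ 0 ∧ ∀ l ∈ L₀.lattice, α * l ∈ L'.lattice) → ∑ j ∈ S, (q j : ℝ) * (∫ x in {x : Fin 1 → ℝ | 0 < x 0 ^ 3 + (A j : ℝ) * x 0 + (B j : ℝ)}, 1 / Real.sqrt (x 0 ^ 3 + (A j : ℝ) * x 0 + (B j : ℝ))) = 0 :=
  Summit.KontsevichZagierPeriods.IsogenyCertificates.XMapKernelStubs.ClassReduction.stub_classReduction

/-- **R-b2** (LANDED p94369, aux p93902) — the non-CM class: given rigidity (R-b0) and radical independence (R-b4), a vanishing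
`ℚ`-combination of full real periods supported on curves whose period lattices are all lattice-isogenous
to ONE non-CM lattice with rational invariants, pairwise without rational multiplier, is trivial
(Masser's `ℚ̄`-independence of `ω₁, ω₂` + real/imaginary multipliers + `γ² ∈ ℚ`). -/
theorem stub_nonCMClass : (∀ (L L' : PeriodPair) (γ : ℂ) (σ : ℂ ≃+* ℂ), (∃ q : ℚ, (q : ℂ) = L.g₂) → (∃ q : ℚ, (q : ℂ) = L.g₃) → (∃ q : ℚ, (q : ℂ) = L'.g₂) → (∃ q : ℚ, (q : ℂ) = L'.g₃) → γ ≠ 0 → (∀ l ∈ L.lattice, γ * l ∈ L'.lattice) → ∀ l ∈ L.lattice, σ γ * l ∈ L'.lattice) → (∀ (m : ℕ), 0 < m → ∀ (r : ℕ) (x : Fin r → ℝ) (c : Fin r → ℚ), (∀ j, 0 < x j) → (∀ j, ∃ a : ℚ, x j ^ m = (a : ℝ)) → (∀ j j', j ≠ j' → ¬ ∃ a : ℚ, x j = (a : ℝ) * x j') → ∑ j, (c j : ℝ) * x j = 0 → ∀ j, c j = 0) → ∀ (k : ℕ) (A B : Fin k → ℤ) (q : Fin k → ℚ) (S : Finset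 (Fin k)) (L₀ : PeriodPair), (∀ i, 4 * A i ^ 3 + 27 * B i ^ 2 ≠ 0) → (∃ q₀ : ℚ, (q₀ : ℂ) = L₀.g₂) → (∃ q₀ : ℚ, (q₀ : ℂ) = L₀.g₃) → ¬ L₀.HasCM → (∀ j ∈ S, ∃ (L' : PeriodPair) (α : ℂ), L'.g₂ = -4 * (A j : ℂ) ∧ L'.g₃ = -4 * (B j : ℂ) ∧ α ≠ 0 ∧ ∀ l ∈ L₀.lattice, α * l ∈ L'.lattice) → (∀ i ∈ S, ∀ j ∈ S, i ≠ j → ¬ ∃ (L L' : PeriodPair) (c : ℚ), L.g₂ = -4 * (A i : ℂ) ∧ L.g₃ = -4 * (B i : ℂ) ∧ L'.g₂ = -4 * (A j : ℂ) ∧ L'.g₃ = -4 * (B j : ℂ) ∧ c ≠ 0 ∧ ∀ l ∈ L.lattice, (c : ℂ) * l ∈ L'.lattice) → ∑ j ∈ S, (q j : ℝ) * (∫ x in {x : Fin 1 → ℝ | 0 < x 0 ^ 3 + (A j : ℝ) * x 0 + (B j : ℝ)}, 1 / Real.sqrt (x 0 ^ 3 + (A j : ℝ) * x 0 + (B j :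 ℝ))) = 0 → ∀ j ∈ S, q j = 0 :=
  Summit.KontsevichZagierPeriods.IsogenyCertificates.XMapKernelStubs.NonCMClass.stub_nonCMClass

/-- **R-b3** (LANDED p94914, aux p94620) — the CM class: as R-b2 but for a CM lattice `L₀` (all lattices of the class span `K·Ω₀ⱼ`
over `ℚ`, the ratios `Ω₀ⱼ/Ω₀(L₀)` are positive real radicals of rationals of exponent dividing `12`, and
commensurable spans give rational multipliers). -/
theorem stub_cmClass : (∀ (L L' : PeriodPair) (γ : ℂ) (σ : ℂ ≃+* ℂ), (∃ q : ℚ, (q : ℂ) = L.g₂) → (∃ q : ℚ, (q : ℂ) = L.g₃) → (∃ q : ℚ, (q : ℂ) = L'.g₂) → (∃ q : ℚ, (q : ℂ) = L'.g₃) → γ ≠ 0 → (∀ l ∈ L.lattice, γ * l ∈ L'.lattice) → ∀ l ∈ L.lattice, σ γ * l ∈ L'.lattice) → (∀ (m : ℕ), 0 < m → ∀ (r : ℕ) (x : Fin r → ℝ) (c : Fin r → ℚ), (∀ j, 0 < x j) → (∀ j, ∃ a : ℚ, x j ^ m = (a : ℝ)) → (∀ j j', j ≠ j' → ¬ ∃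 a : ℚ, x j = (a : ℝ) * x j') → ∑ j, (c j : ℝ) * x j = 0 → ∀ j, c j = 0) → ∀ (k : ℕ) (A B : Fin k → ℤ) (q : Fin k → ℚ) (S : Finset (Fin k)) (L₀ : PeriodPair), (∀ i, 4 * A i ^ 3 + 27 * B i ^ 2 ≠ 0) → (∃ q₀ : ℚ, (q₀ : ℂ) = L₀.g₂) → (∃ q₀ : ℚ, (q₀ : ℂ) = L₀.g₃) → L₀.HasCM → (∀ j ∈ S, ∃ (L' : PeriodPair) (α : ℂ), L'.g₂ = -4 * (A j : ℂ) ∧ L'.g₃ = -4 * (B j : ℂ) ∧ α ≠ 0 ∧ ∀ l ∈ L₀.lattice, α * l ∈ L'.lattice) → (∀ i ∈ S, ∀ j ∈ S, i ≠ j → ¬ ∃ (L L' : PeriodPair) (c : ℚ), L.g₂ = -4 * (A i : ℂ) ∧ L.g₃ = -4 * (B i : ℂ) ∧ L'.g₂ = -4 * (A j : ℂ) ∧ L'.g₃ = -4 * (B j : ℂ) ∧ c ≠ 0 ∧ ∀ l ∈ L.lattice, (c : ℂ) * l ∈ L'.lattice) → ∑ j ∈ S, (q j : ℝ) * (∫ x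 in {x : Fin 1 → ℝ | 0 < x 0 ^ 3 + (A j : ℝ) * x 0 + (B j : ℝ)}, 1 / Real.sqrt (x 0 ^ 3 + (A j : ℝ) * x 0 + (B j : ℝ))) = 0 → ∀ j ∈ S, q j = 0 :=
  Summit.KontsevichZagierPeriods.IsogenyCertificates.XMapKernelStubs.CMClass.stub_cmClass

/-- **R-b4** (LANDED p92767) — linear independence of positive real radicals (Besicovitch 1940 / Mordell 1953): positive
reals with `m`-th powers rational and pairwise irrational ratios are `ℚ`-linearly independent. -/
theorem stub_radicalIndependence : ∀ (m : ℕ), 0 < m → ∀ (r : ℕ) (x : Fin r → ℝ) (c : Fin r → ℚ), (∀ j, 0 < x j) → (∀ j, ∃ a : ℚ, x j ^ m = (a : ℝ)) → (∀ j j', j ≠ j' → ¬ ∃ a : ℚ, x j = (a : ℝ) * x j') → ∑ j, (c j : ℝ) * x j = 0 → ∀ j, c j = 0 :=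
  Summit.KontsevichZagierPeriods.IsogenyCertificates.XMapKernelStubs.RadicalIndependence.stub_radicalIndependence

/-- **C** (LANDED p95059, lead) — cell collapse (the lever): reps exist + orbit collapse + real-period independence ⇒ every kernel
element supported on the real-period sector lies in `closure gens`, by relator paths and rule (1b). -/
theorem stub_cellCollapse : (∀ (A B : ℤ) (a : ℚ), 4 * A ^ 3 + 27 * B ^ 2 ≠ 0 → ∃ r : Literature.NumberTheory.Transcendental.KZ.IntegralRep 1, r.domain = {x | 0 < x 0 ^ 3 + (A : ℝ) * x 0 + (B : ℝ)} ∧ r.integrand = fun x => (a : ℝ) / Real.sqrt (x 0 ^ 3 + (A : ℝ) * x 0 + (B : ℝ))) → (∀ (A B A' B' : ℤ), 4 * A ^ 3 + 27 * B ^ 2 ≠ 0 → 4 * A' ^ 3 + 27 * B' ^ 2 ≠ 0 → (∃ (f g : Polynomial ℚ) (c : ℚ), Polynomial.derivative f * g - f * Polynomial.derivative g ≠ 0 ∧ Polynomial.C (c ^ 2) * g * (f ^ 3 + Polynomial.C (A' : ℚ) * f * g ^ 2 + Polynomial.C (B' : ℚ) * g ^ 3) = (Polynomial.X ^ 3 +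 Polynomial.C (A : ℚ) * Polynomial.X + Polynomial.C (B : ℚ)) * (Polynomial.derivative f * g - f * Polynomial.derivative g) ^ 2) → ∃ q : ℚ, 0 < q ∧ (∫ x in {x : Fin 1 → ℝ | 0 < x 0 ^ 3 + (A : ℝ) * x 0 + (B : ℝ)}, 1 / Real.sqrt (x 0 ^ 3 + (A : ℝ) * x 0 + (B : ℝ))) = (q : ℝ) * ∫ x in {x : Fin 1 → ℝ | 0 < x 0 ^ 3 + (A' : ℝ) * x 0 + (B' : ℝ)}, 1 / Real.sqrt (x 0 ^ 3 + (A' : ℝ) * x 0 + (B' : ℝ))) → (∀ (k : ℕ) (A B : Fin k → ℤ) (q : Fin k → ℚ), (∀ i, 4 * A i ^ 3 + 27 * B i ^ 2 ≠ 0) → (∀ i j, i ≠ j → ¬ ∃ (f g : Polynomial ℚ) (c : ℚ), Polynomial.derivative f * g - f * Polynomial.derivative g ≠ 0 ∧ Polynomial.C (c ^ 2) * g * (f ^ 3 + Polynomial.C (A j : ℚ) * f * g ^ 2 + Polynomial.C (B j : ℚ) * g ^ 3) = (Polynomial.X ^ 3 + Polynomial.C (A i : ℚ) * Polynomial.X +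 Polynomial.C (B i : ℚ)) * (Polynomial.derivative f * g - f * Polynomial.derivative g) ^ 2) → ∑ i, (q i : ℝ) * (∫ x in {x : Fin 1 → ℝ | 0 < x 0 ^ 3 + (A i : ℝ) * x 0 + (B i : ℝ)}, 1 / Real.sqrt (x 0 ^ 3 + (A i : ℝ) * x 0 + (B i : ℝ))) = 0 → ∀ i, q i = 0) → ∀ c ∈ AddSubgroup.closure {d : Literature.NumberTheory.Transcendental.KZ.FormalRep | ∃ (A B : ℤ) (a : ℚ) (r : Literature.NumberTheory.Transcendental.KZ.IntegralRep 1), 4 * A ^ 3 + 27 * B ^ 2 ≠ 0 ∧ r.domain = {x | 0 < x 0 ^ 3 + (A : ℝ) * x 0 + (B : ℝ)} ∧ Set.EqOn r.integrand (fun x => (a : ℝ) / Real.sqrt (x 0 ^ 3 + (A : ℝ) * x 0 + (B : ℝ))) r.domain ∧ d = Literature.NumberTheory.Transcendental.KZ.of r}, Literature.NumberTheory.Transcendental.KZ.eval c = 0 → c ∈ AddSubgroup.closure Summit.KontsevichZagierPeriods.XMapKernel.Negative.gens :=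
  Summit.KontsevichZagierPeriods.IsogenyCertificates.XMapKernelStubs.CellCollapse.stub_cellCollapse

/-! ### HW (closed, registration 3) and the one open stub K -/

/-- **HW** — CLOSED (registration 3, lead a2): the transcendence input, Huber–Wüstholz 2022 Thm 15.3 (1) for
`[ℤ →⁰ 𝔾ₘ] × E₁ × ⋯ × E_k` (pairwise non-isogenous curves, CM allowed), is the tree's theorem
`HuberWustholzManyCurvePeriods_holds` (Baker–Wüstholz analytic subgroup theorem + Philippon's zero estimate,
`ManyCurveThetaClassification.lean`); landed for this crux as `XMapKernelCells.stub_huberWustholzManyCurvePeriods`. -/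
theorem stub_huberWustholzManyCurvePeriods : Literature.NumberTheory.Transcendental.HuberWustholzManyCurvePeriods :=
  HuberWustholzManyCurvePeriods_holds

/-- **K** — reduction to the real-period sector: THE ONLY OPEN STUB. It is EQUIVALENT to the summit
`KontsevichZagierPeriods`, unconditionally (`XMapKernelCells.reductionToRealPeriodSector_iff_summit_holds`; given the
now unconditional real-period cell, K ↔ the crux ↔ the summit, Disproof F1 ∘ proved `XMapPeriodTransfer`). No stub,
worker or line can close it short of the Kontsevich–Zagier period conjecture itself; carried openly. -/
theorem stub_reductionToRealPeriodSector : ∀ c : Literature.NumberTheory.Transcendental.KZ.FormalRep, Literature.NumberTheory.Transcendental.KZ.eval c = 0 → ∃ c' ∈ AddSubgroup.closure {d : Literature.NumberTheory.Transcendental.KZ.FormalRep | ∃ (A B : ℤ) (a : ℚ) (r : Literature.NumberTheory.Transcendental.KZ.IntegralRep 1), 4 * A ^ 3 + 27 * B ^ 2 ≠ 0 ∧ r.domain = {x | 0 < x 0 ^ 3 + (A : ℝ) * x 0 + (B : ℝ)} ∧ Set.EqOn r.integrand (fun x => (a : ℝ) / Real.sqrt (x 0 ^ 3 + (A : ℝ)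 * x 0 + (B : ℝ))) r.domain ∧ d = Literature.NumberTheory.Transcendental.KZ.of r}, c - c' ∈ AddSubgroup.closure Summit.KontsevichZagierPeriods.XMapKernel.Negative.gens := by
  sorry

/-! ### Glue -/

/-- **R-b, glued**: independence modulo rational lattice multipliers, from R-b0 … R-b4 over the named fact.
For `i`, R-b1 gives a lattice `L₀` of curve `i` whose lattice-isogeny class sum vanishes; that class
(containing `i`) is handled by R-b3 if `L₀` has CM and by R-b2 otherwise. -/
theorem independenceModRatMult (hHW : Literature.NumberTheory.Transcendental.HuberWustholzManyCurvePeriods) :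
    ∀ (k : ℕ) (A B : Fin k → ℤ) (q : Fin k → ℚ), (∀ i, 4 * A i ^ 3 + 27 * B i ^ 2 ≠ 0) →
      (∀ i j, i ≠ j → ¬ ∃ (L L' : PeriodPair) (c : ℚ), L.g₂ = -4 * (A i : ℂ) ∧ L.g₃ = -4 * (B i : ℂ) ∧
        L'.g₂ = -4 * (A j : ℂ) ∧ L'.g₃ = -4 * (B j : ℂ) ∧ c ≠ 0 ∧ ∀ l ∈ L.lattice, (c : ℂ) * l ∈ L'.lattice) →
      ∑ i, (q i : ℝ) * (∫ x in {x : Fin 1 → ℝ | 0 < x 0 ^ 3 + (A i : ℝ) * x 0 + (B i : ℝ)},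
        1 / Real.sqrt (x 0 ^ 3 + (A i : ℝ) * x 0 + (B i : ℝ))) = 0 → ∀ i, q i = 0 := by
  classical
  intro k A B q hns hnrm hsum i
  obtain ⟨L₀, h2, h3, hclass⟩ := stub_classReduction hHW k A B q hns hsum i
  set S : Finset (Fin k) := Finset.univ.filter (fun j => ∃ (L' : PeriodPair) (α : ℂ),
    L'.g₂ = -4 * (A j : ℂ) ∧ L'.g₃ = -4 * (B j : ℂ) ∧ α ≠ 0 ∧ ∀ l ∈ L₀.lattice, α * l ∈ L'.lattice) with hSdef
  have hS : ∀ j, j ∈ S ↔ ∃ (L' : PeriodPair) (α : ℂ),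
      L'.g₂ = -4 * (A j : ℂ) ∧ L'.g₃ = -4 * (B j : ℂ) ∧ α ≠ 0 ∧ ∀ l ∈ L₀.lattice, α * l ∈ L'.lattice := by
    intro j
    simp [hSdef]
  have hsumS := hclass S hS
  have hmem : ∀ j ∈ S, ∃ (L' : PeriodPair) (α : ℂ),
      L'.g₂ = -4 * (A j : ℂ) ∧ L'.g₃ = -4 * (B j : ℂ) ∧ α ≠ 0 ∧ ∀ l ∈ L₀.lattice, α * l ∈ L'.lattice :=
    fun j hj => (hS j).1 hj
  have hnrmS : ∀ i ∈ S, ∀ j ∈ S, i ≠ j → ¬ ∃ (L L' : PeriodPair) (c : ℚ), L.g₂ = -4 * (A i : ℂ) ∧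
      L.g₃ = -4 * (B i : ℂ) ∧ L'.g₂ = -4 * (A j : ℂ) ∧ L'.g₃ = -4 * (B j : ℂ) ∧ c ≠ 0 ∧
      ∀ l ∈ L.lattice, (c : ℂ) * l ∈ L'.lattice :=
    fun i _ j _ hij => hnrm i j hij
  have hg₂ : ∃ q₀ : ℚ, (q₀ : ℂ) = L₀.g₂ := ⟨-4 * A i, by rw [h2]; push_cast; ring⟩
  have hg₃ : ∃ q₀ : ℚ, (q₀ : ℂ) = L₀.g₃ := ⟨-4 * B i, by rw [h3]; push_cast; ring⟩
  have hi : i ∈ S := (hS i).2 ⟨L₀, 1, h2, h3, one_ne_zero, fun l hl => by simpa using hl⟩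
  by_cases hCM : L₀.HasCM
  · exact stub_cmClass stub_multiplierRigidity stub_radicalIndependence k A B q S L₀ hns hg₂ hg₃ hCM hmem
      hnrmS hsumS i hi
  · exact stub_nonCMClass stub_multiplierRigidity stub_radicalIndependence k A B q S L₀ hns hg₂ hg₃ hCM
      hmem hnrmS hsumS i hi

/-- **Composition.** S, V, R-a, R-b0…R-b4, C, HW (all landed / proved) and K (stub) ⇒ the crux `XMapKernel`,
concluded by name. Open after registration 3: exactly {K}, and K ↔ the summit. -/
theorem XMapKernel_of : XMapKernel := by
  have hHW := stub_huberWustholzManyCurvePeriods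
  -- real-period independence in datum form, from glued R-b and the contrapositive of R-a
  have hRPI : ∀ (k : ℕ) (A B : Fin k → ℤ) (q : Fin k → ℚ), (∀ i, 4 * A i ^ 3 + 27 * B i ^ 2 ≠ 0) →
      (∀ i j, i ≠ j → ¬ ∃ (f g : Polynomial ℚ) (c : ℚ),
        Polynomial.derivative f * g - f * Polynomial.derivative g ≠ 0 ∧
        Polynomial.C (c ^ 2) * g * (f ^ 3 + Polynomial.C (A j : ℚ) * f * g ^ 2 + Polynomial.C (B j : ℚ) * g ^ 3) =
          (Polynomial.X ^ 3 + Polynomial.C (A i : ℚ) * Polynomial.X + Polynomial.C (B i : ℚ)) *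
            (Polynomial.derivative f * g - f * Polynomial.derivative g) ^ 2) →
      ∑ i, (q i : ℝ) * (∫ x in {x : Fin 1 → ℝ | 0 < x 0 ^ 3 + (A i : ℝ) * x 0 + (B i : ℝ)},
        1 / Real.sqrt (x 0 ^ 3 + (A i : ℝ) * x 0 + (B i : ℝ))) = 0 → ∀ i, q i = 0 := by
    intro k A B q hns hnd hsum
    refine independenceModRatMult hHW k A B q hns ?_ hsum
    intro i j hij hrat
    obtain ⟨L, L', c, h1, h2, h3, h4, hc, hmul⟩ := hrat
    exact hnd i j hij
      (stub_datumOfRatMult (A i) (B i) (A j) (B j) (hns i) (hns j) L L' c h1 h2 h3 h4 hc hmul)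
  have hCell := stub_cellCollapse stub_sectorRepsExist stub_orbitCollapse hRPI
  rw [Summit.KontsevichZagierPeriods.XMapKernel.Negative.crux_iff]
  intro c hc
  obtain ⟨c', hc', hcc'⟩ := stub_reductionToRealPeriodSector c hc
  have hdiff : KZ.eval (c - c') = 0 :=
    AddMonoidHom.mem_ker.1 (Summit.KontsevichZagierPeriods.XMapKernel.Negative.closure_gens_le_ker_eval hcc')
  have hc'0 : KZ.eval c' = 0 := by
    rw [map_sub, hc, zero_sub, neg_eq_zero] at hdiff
    exact hdiff
  have hc'mem := hCell c' hc' hc'0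
  have : c = (c - c') + c' := by abel
  rw [this]
  exact AddSubgroup.add_mem _ hcc' hc'mem

end Summit.KontsevichZagierPeriods.KontsevichZagierPeriods.Cruxes.XMapKernel.Lines.IsogenyOrbitCollapse
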